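import Summits.QuantumFields.YangMills.Theorems.BalabanLadderIRcofSchurFejerAmpChar
import HarnessLib

/-!
# Schur–Fejér splitting §8a–c: joint spectral amplitudes of a finite central subgroup, basis coordinates, orthogonality, completeness

For a finite `Γ ≤ Z(H)` and a faithful unitary `ρH : LatticeRep H`: (8a) JOINT SPECTRAL AMPLITUDES `jointAmp ρH Γ ψ = Σ_{γ∈Γ} ψ(γ)⁻¹ • ρH γ`
of a multiplicative nowhere-zero `ψ : Γ → ℂ` commute with `ρH(H)` (`jointAmp_comm`) and satisfy `ρH(γ₀) P_ψ = ψ(γ₀) • P_ψ` (`rho_mul_jointAmp`),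
so `isTwistChar_jointAmpChar : P_ψ ≠ 0 → IsTwistChar γ₀ (ψ γ₀) (ampChar ρH P_ψ)`; (8b) COORDINATES from a basis `e : Γ ≃* Π_i ℤ_{n_i}`:
`coord`, `elemOf`, `coord_lt ∕ coord_mul ∕ coord_one ∕ eq_one_of_coord_eq_zero ∕ coord_elemOf ∕ elemOf_coord`, the characters
`twistOn e ω l γ = Π_i ω_i^{l_i c_i(γ)}` (`twistOn_mul ∕ _ne_zero ∕ _elemOf`) and ORTHOGONALITY `sum_twistOn_inv`
(`Σ_{l ∈ box} ψ_l(γ)⁻¹ = [γ = 1] Π_i n_i`); (8c) COMPLETENESS `sum_jointAmp_twistOn : Σ_{l ∈ box} P_l = (Π n_i) • 1` and, by faithfulness,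
`exists_twistOn_nondegenerate`.

HONEST LABEL.  The Yang–Mills mass gap (Clay) is NOT proved; `IRcof` ∕ `IR` are 0 ∕ 1 proved; this is finite-dimensional representation
theory toward ONE stub (S2ᵛ `EquipartitionSeam.SplitVanishing`) of census row 47 (mechanism 0, transported; class PWP); nothing continuum ∕ OS ∕ Clay.
Source: ideator `ym-ir-idea-22` g4, Lines core `Cruxes/IRcof/Lines/equipartition_seam_SchurFejerCore.lean` rev 11 (crux write 80e9377d57ba), verbatim.

LANDING NOTE (custody LEAD ym-ir-line-ab-p1 g7): gate-forced only — one-line docstrings added where the lint requires them.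
-/

set_option autoImplicit false

noncomputable section

open Finset Complex

namespace Summit.QuantumFields.YangMills.Cruxes.IRcof.EquipartitionSeam.SchurFejer

open scoped ComplexOrder Matrix

section JointAmp

open Literature.MathematicalPhysics.QuantumFieldTheory

variable {H : Type} [Group H] [TopologicalSpace H]

/-- The JOINT SPECTRAL AMPLITUDE `P_ψ = Σ_{γ ∈ Γ} ψ(γ)⁻¹ • ρH(γ)` of a function `ψ : Γ → ℂ` on a finite subgroup. -/
def jointAmp (ρH : LatticeRep H) (Γ : Subgroup H) [Fintype Γ] (ψ : Γ → ℂ) :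
    Matrix (Fin ρH.N) (Fin ρH.N) ℂ :=
  ∑ γ : Γ, (ψ γ)⁻¹ • ρH.ρ (γ : H)

/-- `P_ψ` commutes with `ρH(H)` when `Γ` is central. -/
theorem jointAmp_comm (ρH : LatticeRep H) {Γ : Subgroup H} [Fintype Γ] (hcen : Γ ≤ Subgroup.center H)
    (ψ : Γ → ℂ) (h : H) : jointAmp ρH Γ ψ * ρH.ρ h = ρH.ρ h * jointAmp ρH Γ ψ := by
  unfold jointAmp
  rw [Finset.sum_mul, Finset.mul_sum]
  refine Finset.sum_congr rfl fun γ _ => ?_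
  rw [Matrix.smul_mul, Matrix.mul_smul, latticeRep_comm_of_mem_center ρH (hcen γ.2)]

/-- EIGEN-RELATION `ρH(γ₀) P_ψ = ψ(γ₀) P_ψ` for a multiplicative nowhere-zero `ψ` (reindex `γ ↦ γ₀ γ`). -/
theorem rho_mul_jointAmp (ρH : LatticeRep H) {Γ : Subgroup H} [Fintype Γ] {ψ : Γ → ℂ}
    (hmul : ∀ a b, ψ (a * b) = ψ a * ψ b) (hne : ∀ a, ψ a ≠ 0) (γ₀ : Γ) :
    ρH.ρ (γ₀ : H) * jointAmp ρH Γ ψ = ψ γ₀ • jointAmp ρH Γ ψ := by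
  unfold jointAmp
  rw [Finset.mul_sum, Finset.smul_sum]
  have hre : ∑ γ : Γ, ψ γ₀ • ((ψ (γ₀ * γ))⁻¹ • ρH.ρ ((γ₀ * γ : Γ) : H)) =
      ∑ γ : Γ, ψ γ₀ • ((ψ γ)⁻¹ • ρH.ρ (γ : H)) :=
    Fintype.sum_bijective (γ₀ * ·) (Group.mulLeft_bijective γ₀) _ _ (fun _ => rfl)
  rw [← hre]
  refine Finset.sum_congr rfl fun γ _ => ?_
  rw [hmul, mul_inv, Subgroup.coe_mul, map_mul, smul_smul, ← mul_assoc, mul_inv_cancel₀ (hne γ₀), one_mul,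
    Matrix.mul_smul]

/-- `jointAmp_trace_ne_zero` (see the module docstring; verbatim from the Lines core §8). -/
theorem jointAmp_trace_ne_zero {ρH : LatticeRep H} {Γ : Subgroup H} [Fintype Γ] {ψ : Γ → ℂ}
    (hA : jointAmp ρH Γ ψ ≠ 0) : ((jointAmp ρH Γ ψ)ᴴ * jointAmp ρH Γ ψ).trace ≠ 0 := fun htr =>
  hA (Matrix.conjTranspose_mul_self_eq_zero.1 ((posSemidef_ampProj _).trace_eq_zero_iff.1 htr))

/-- The amplitude character of a non-zero joint amplitude is a twist character for EVERY `γ₀ ∈ Γ`, twist `ψ(γ₀)`. -/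
theorem isTwistChar_jointAmpChar (ρH : LatticeRep H) {Γ : Subgroup H} [Fintype Γ]
    (hcen : Γ ≤ Subgroup.center H) {ψ : Γ → ℂ} (hmul : ∀ a b, ψ (a * b) = ψ a * ψ b)
    (hne : ∀ a, ψ a ≠ 0) (hA : jointAmp ρH Γ ψ ≠ 0) (γ₀ : Γ) :
    IsTwistChar (γ₀ : H) (ψ γ₀) (ampChar ρH (jointAmp ρH Γ ψ)) :=
  isTwistChar_ampChar ρH (jointAmp_comm ρH hcen ψ) (rho_mul_jointAmp ρH hmul hne γ₀)
    (jointAmp_trace_ne_zero hA)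

end JointAmp

section Coord

variable {H : Type} [Group H] [TopologicalSpace H]
variable {Γ : Subgroup H} {ι : Type} {n : ι → ℕ}

/-- Coordinates of `γ ∈ Γ` in a basis `e : Γ ≃* Π_i ℤ_{n_i}`. -/
def coord (e : Γ ≃* ((i : ι) → Multiplicative (ZMod (n i)))) (i : ι) (γ : Γ) : ℕ :=
  (Multiplicative.toAdd (e γ i)).val

/-- The element of `Γ` with prescribed coordinates. -/
def elemOf (e : Γ ≃* ((i : ι) → Multiplicative (ZMod (n i)))) (a : ι → ℕ) : Γ :=
  e.symm (fun i => Multiplicative.ofAdd ((a i : ℕ) : ZMod (n i)))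

omit [TopologicalSpace H] in
/-- `coord_lt` (see the module docstring; verbatim from the Lines core §8). -/
theorem coord_lt (e : Γ ≃* ((i : ι) → Multiplicative (ZMod (n i)))) (hn : ∀ i, 0 < n i) (i : ι)
    (γ : Γ) : coord e i γ < n i := by
  haveI : NeZero (n i) := ⟨(hn i).ne'⟩
  exact ZMod.val_lt _

omit [TopologicalSpace H] in
/-- `coord_mul` (see the module docstring; verbatim from the Lines core §8). -/
theorem coord_mul (e : Γ ≃* ((i : ι) → Multiplicative (ZMod (n i)))) (hn : ∀ i, 0 < n i) (i : ι)
    (a b : Γ) : coord e i (a * b) = (coord e i a + coord e i b) % n i := by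
  haveI : NeZero (n i) := ⟨(hn i).ne'⟩
  unfold coord
  rw [map_mul, Pi.mul_apply, toAdd_mul, ZMod.val_add]

omit [TopologicalSpace H] in
/-- `coord_one` (see the module docstring; verbatim from the Lines core §8). -/
theorem coord_one (e : Γ ≃* ((i : ι) → Multiplicative (ZMod (n i)))) (i : ι) : coord e i 1 = 0 := by
  unfold coord
  rw [map_one, Pi.one_apply, toAdd_one, ZMod.val_zero]

omit [TopologicalSpace H] in
/-- `eq_one_of_coord_eq_zero` (see the module docstring; verbatim from the Lines core §8). -/
theorem eq_one_of_coord_eq_zero (e : Γ ≃* ((i : ι) → Multiplicative (ZMod (n i)))) {γ : Γ}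
    (hγ : ∀ i, coord e i γ = 0) : γ = 1 := by
  apply e.injective
  rw [map_one]
  funext i
  have h := hγ i
  unfold coord at h
  rw [ZMod.val_eq_zero] at h
  rw [Pi.one_apply, ← ofAdd_toAdd (e γ i), h]
  rfl

omit [TopologicalSpace H] in
/-- `coord_elemOf` (see the module docstring; verbatim from the Lines core §8). -/
theorem coord_elemOf (e : Γ ≃* ((i : ι) → Multiplicative (ZMod (n i))))
    (a : ι → ℕ) (ha : ∀ i, a i < n i) (i : ι) : coord e i (elemOf e a) = a i := by
  unfold coord elemOf
  rw [MulEquiv.apply_symm_apply, toAdd_ofAdd, ZMod.val_natCast, Nat.mod_eq_of_lt (ha i)]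

omit [TopologicalSpace H] in
/-- `elemOf_coord` (see the module docstring; verbatim from the Lines core §8). -/
theorem elemOf_coord (e : Γ ≃* ((i : ι) → Multiplicative (ZMod (n i)))) (hn : ∀ i, 0 < n i) (γ : Γ) :
    elemOf e (fun i => coord e i γ) = γ := by
  haveI : ∀ i, NeZero (n i) := fun i => ⟨(hn i).ne'⟩
  unfold elemOf coord
  simp_rw [ZMod.natCast_zmod_val, ofAdd_toAdd]
  exact e.symm_apply_apply γ

variable [Fintype ι]

/-- The characters `ψ_l(γ) = Π_i ω_i^{l_i c_i(γ)}`. -/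
def twistOn (e : Γ ≃* ((i : ι) → Multiplicative (ZMod (n i)))) (ω : ι → ℂ) (l : ι → ℕ) (γ : Γ) : ℂ :=
  ∏ i, ω i ^ (l i * coord e i γ)

omit [TopologicalSpace H] in
/-- `twistOn_mul` (see the module docstring; verbatim from the Lines core §8). -/
theorem twistOn_mul (e : Γ ≃* ((i : ι) → Multiplicative (ZMod (n i)))) (hn : ∀ i, 0 < n i) {ω : ι → ℂ}
    (hωN : ∀ i, ω i ^ n i = 1) (l : ι → ℕ) (a b : Γ) :
    twistOn e ω l (a * b) = twistOn e ω l a * twistOn e ω l b := by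
  unfold twistOn
  rw [← Finset.prod_mul_distrib]
  refine Finset.prod_congr rfl fun i _ => ?_
  rw [← pow_add, coord_mul e hn, ← mul_add]
  exact pow_eq_pow_of_modEq (hωN i) ((Nat.mod_modEq _ _).mul_left _)

omit [TopologicalSpace H] in
/-- `twistOn_ne_zero` (see the module docstring; verbatim from the Lines core §8). -/
theorem twistOn_ne_zero (e : Γ ≃* ((i : ι) → Multiplicative (ZMod (n i)))) {ω : ι → ℂ}
    (hω0 : ∀ i, ω i ≠ 0) (l : ι → ℕ) (γ : Γ) : twistOn e ω l γ ≠ 0 :=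
  Finset.prod_ne_zero_iff.2 fun i _ => pow_ne_zero _ (hω0 i)

omit [TopologicalSpace H] in
/-- `twistOn_elemOf` (see the module docstring; verbatim from the Lines core §8). -/
theorem twistOn_elemOf (e : Γ ≃* ((i : ι) → Multiplicative (ZMod (n i))))
    (ω : ι → ℂ) (l a : ι → ℕ) (ha : ∀ i, a i < n i) :
    twistOn e ω l (elemOf e a) = ∏ i, (ω i ^ l i) ^ a i := by
  unfold twistOn
  refine Finset.prod_congr rfl fun i _ => ?_
  rw [coord_elemOf e a ha, pow_mul]

omit [TopologicalSpace H] in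
open Classical in
/-- ORTHOGONALITY: `Σ_{l ∈ box} ψ_l(γ)⁻¹ = [γ = 1] · Π n_i`. -/
theorem sum_twistOn_inv [DecidableEq ι] (e : Γ ≃* ((i : ι) → Multiplicative (ZMod (n i))))
    (hn : ∀ i, 0 < n i) {ω : ι → ℂ} (hω : ∀ i, IsPrimitiveRoot (ω i) (n i)) (γ : Γ) :
    ∑ l ∈ Fintype.piFinset (fun i => range (n i)), (twistOn e ω l γ)⁻¹ =
      if γ = 1 then ∏ i, ((n i : ℕ) : ℂ) else 0 := by
  have hfac : ∀ l : ι → ℕ, (twistOn e ω l γ)⁻¹ = ∏ i, ((ω i)⁻¹ ^ coord e i γ) ^ l i := by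
    intro l
    unfold twistOn
    rw [← Finset.prod_inv_distrib]
    refine Finset.prod_congr rfl fun i _ => ?_
    rw [← inv_pow, mul_comm, pow_mul]
  rw [Finset.sum_congr rfl (fun l _ => hfac l),
    ← Finset.prod_univ_sum (fun i => range (n i)) (fun i j => ((ω i)⁻¹ ^ coord e i γ) ^ j)]
  by_cases hγ : γ = 1
  · rw [if_pos hγ]
    refine Finset.prod_congr rfl fun i _ => ?_
    rw [hγ, coord_one, pow_zero]
    simp
  · rw [if_neg hγ]
    obtain ⟨i, hi⟩ : ∃ i, coord e i γ ≠ 0 := by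
      by_contra hall
      push Not at hall
      exact hγ (eq_one_of_coord_eq_zero e hall)
    refine Finset.prod_eq_zero (Finset.mem_univ i) ?_
    have hζN : ((ω i)⁻¹ ^ coord e i γ) ^ n i = 1 := by
      rw [← pow_mul, mul_comm, pow_mul, inv_pow, (hω i).pow_eq_one, inv_one, one_pow]
    have hζ1 : (ω i)⁻¹ ^ coord e i γ ≠ 1 :=
      (hω i).inv.pow_ne_one_of_pos_of_lt hi (coord_lt e hn i γ)
    rw [geom_sum_eq hζ1, hζN, sub_self, zero_div]

end Coord

section Completeness

open Literature.MathematicalPhysics.QuantumFieldTheory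

variable {H : Type} [Group H] [TopologicalSpace H]
variable {Γ : Subgroup H} [Fintype Γ] {ι : Type} [Fintype ι] [DecidableEq ι] {n : ι → ℕ}

/-- COMPLETENESS `Σ_{l ∈ box} P_l = (Π n_i) • 1`. -/
theorem sum_jointAmp_twistOn (ρH : LatticeRep H) (e : Γ ≃* ((i : ι) → Multiplicative (ZMod (n i))))
    (hn : ∀ i, 0 < n i) {ω : ι → ℂ} (hω : ∀ i, IsPrimitiveRoot (ω i) (n i)) :
    ∑ l ∈ Fintype.piFinset (fun i => range (n i)), jointAmp ρH Γ (twistOn e ω l) =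
      (∏ i, ((n i : ℕ) : ℂ)) • (1 : Matrix (Fin ρH.N) (Fin ρH.N) ℂ) := by
  unfold jointAmp
  rw [Finset.sum_comm]
  simp_rw [← Finset.sum_smul]
  rw [Finset.sum_congr rfl (fun γ _ => by rw [sum_twistOn_inv e hn hω γ]), Finset.sum_eq_single (1 : Γ)]
  · rw [if_pos rfl, OneMemClass.coe_one, map_one]
  · intro γ _ hγ
    rw [if_neg hγ, zero_smul]
  · intro h
    exact absurd (Finset.mem_univ _) h

/-- FAITHFULNESS ⇒ NON-DEGENERACY: no `m ≠ 0` in the box kills every non-empty joint label. -/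
theorem exists_twistOn_nondegenerate (ρH : LatticeRep H) (e : Γ ≃* ((i : ι) → Multiplicative (ZMod (n i))))
    (hn : ∀ i, 0 < n i) {ω : ι → ℂ} (hω : ∀ i, IsPrimitiveRoot (ω i) (n i)) (m : ι → ℕ)
    (hm : ∀ i, m i < n i) (hm0 : ∃ i, m i ≠ 0) :
    ∃ l ∈ Fintype.piFinset (fun i => range (n i)), jointAmp ρH Γ (twistOn e ω l) ≠ 0 ∧
      ∏ i, (ω i ^ l i) ^ m i ≠ 1 := by
  classical
  have hωN : ∀ i, ω i ^ n i = 1 := fun i => (hω i).pow_eq_one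
  have hω0 : ∀ i, ω i ≠ 0 := fun i => (hω i).ne_zero (hn i).ne'
  by_contra hcon
  push Not at hcon
  set γ₀ : Γ := elemOf e m with hγ₀def
  have hfix : ∀ l ∈ Fintype.piFinset (fun i => range (n i)),
      ρH.ρ (γ₀ : H) * jointAmp ρH Γ (twistOn e ω l) = jointAmp ρH Γ (twistOn e ω l) := by
    intro l hl
    by_cases hA : jointAmp ρH Γ (twistOn e ω l) = 0
    · rw [hA, Matrix.mul_zero]
    · rw [rho_mul_jointAmp ρH (twistOn_mul e hn hωN l) (twistOn_ne_zero e hω0 l) γ₀, hγ₀def,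
        twistOn_elemOf e ω l m hm, hcon l hl hA, one_smul]
  have hsum := sum_jointAmp_twistOn ρH e hn hω
  have h1 : ρH.ρ (γ₀ : H) * ((∏ i, ((n i : ℕ) : ℂ)) • (1 : Matrix (Fin ρH.N) (Fin ρH.N) ℂ)) =
      (∏ i, ((n i : ℕ) : ℂ)) • (1 : Matrix (Fin ρH.N) (Fin ρH.N) ℂ) := by
    conv_rhs => rw [← hsum, ← Finset.sum_congr rfl hfix]
    rw [← hsum, Finset.mul_sum]
  rw [Matrix.mul_smul, Matrix.mul_one] at h1
  have hC : (∏ i, ((n i : ℕ) : ℂ)) ≠ 0 :=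
    Finset.prod_ne_zero_iff.2 fun i _ => Nat.cast_ne_zero.2 (hn i).ne'
  have hone : ρH.ρ (γ₀ : H) = 1 := smul_right_injective (Matrix (Fin ρH.N) (Fin ρH.N) ℂ) hC h1
  have hγ1 : (γ₀ : H) = 1 := ρH.injective (by rw [hone, map_one])
  have hγ1' : γ₀ = 1 := OneMemClass.coe_eq_one.1 hγ1
  obtain ⟨i, hi⟩ := hm0
  apply hi
  rw [← coord_elemOf e m hm i, ← hγ₀def, hγ1', coord_one]

end Completeness

end Summit.QuantumFields.YangMills.Cruxes.IRcof.EquipartitionSeam.SchurFejer
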